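import Mathlib
import Summits.HodgeConjecture.HodgeConjecture.Theorems.HodgeLocusLVLocalFactor

/-!
# Hodge-locus census (cell `pub-hlocus`, ENGINE A, gen 46) — the bookkeeping half of the three-cell
term-wise law (DERIVATION-GK-A.md §5af) as kernel theorems

certified instances and evidence bearing on the general Hodge conjecture; no claim.

GENERAL (non-computational) and DEFINITION-FREE lemma sheet continuing `HodgeLocusLVLocalFactor.lean`
(cell anchor 53); no census data is used.  Context: ENGINE A's transcription of the second display of
[cite: LauterViray2015SingularModuli, Thm. 1.5] (arXiv:1206.6942) is `T_r := Σ_x ρ(m_x)·𝔄(m_x / ℓ^r)`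
(term `:= 0` when `ℓ^r ∤ m_x`), with `𝔄(N) = Σ_{q ∈ Q, q ∣ N} ε_q σ_χ(N/q)` a signed inclusion–exclusion sum
of twisted divisor sums `σ_χ(M) = Σ_{t ∣ M} χ(t)` over a FIXED finite set `Q` of moduli coprime to the prime
`ℓ` (products of `p²`, `p³` over primes `p ≠ ℓ` of the conductor; summing over `q ∣ N` makes `Q` independent
of `N`).  §5af derives a THREE-CELL LAW for `r ↦ T_r` from Lemma 1 (`ℓ`-local factorisation of `𝔄`),
Lemmas 2–3 (Hilbert-symbol product formula: a nonzero term has `(d₁, −m)_ℓ = −1`, so odd `v_ℓ(m)` in the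
inert cell and no nonzero term in the split cell; mechanism of [cite: GrossZagier1985SingularModuli, §3],
[cite: LauterViray2015SingularModuli, Prop. 8.1]) and Lemma 4 (valuation floors).  Kernel-checked HERE,
with `χ`, `Q`, `ε`, `ρ`, the index set and the valuations abstract:
* Part A — Lemma 1 in full: a signed inclusion–exclusion sum over moduli coprime to `ℓ` inherits any
  `ℓ`-local factorisation of its summand (`inclExcl_local_factor`); with anchor 53's
  `divisorSum_prime_pow_mul`: `𝔄(ℓ^e n) = (Σ_{i≤e} χ(ℓ)^i)·𝔄(n)` for `ℓ ∤ n` (`frakA_local_factor`), the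
  factor being `[e even]`, `1`, `e + 1` for `χ(ℓ) = −1, 0, 1` (`localFactor_inert/_ramified/_split`).
* Part B — one term: for `m = ℓ^v m'`, `ℓ ∤ m'`: `[ℓ^r ∣ m]·ρ·F(m/ℓ^r) = [r ≤ v]·(ρ F(m'))·c(v − r)`
  (`term_eq_core`, `sum_eq_core`; incl. `ℓ^r ∣ ℓ^v m' ↔ r ≤ v`, `ℓ^v m' / ℓ^r = ℓ^{v−r} m'`).
* Part C — the law for core sums `Σ_x [r ≤ v_x]·w_x·c(v_x − r)` from per-term hypotheses: (S) all core
  weights zero ⇒ `T_r = 0`; (I) `c(e) = [e even]`, nonzero weights have odd `v_x` ⇒ `T_r = 0` for even `r`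
  (incl. (Z) `T_0 = 0`), and with `v_x ≥ K` also `T_r = T_1` for odd `r ≤ K` (cell: `K = 2k+1`); (R) `c ≡ 1`,
  nonzero weights have `v_x ≥ K` ⇒ `T_r = Σ_x w_x` for all `r ≤ K` (cell: `K = 2k` for `ℓ = 2`, `2k+1` for
  odd `ℓ`); `v_x ≤ K'` on nonzero weights ⇒ `T_r = 0` for `r > K'`.
* Part D — the same in the arithmetic shape of A's `T_r` (`law_split`, `law_inert_even`, `law_inert_odd`,
  `law_ramified`, `law_eq_zero_of_gt`).
* Part E — Lemma 4 (I) for a prime `ℓ` not dividing the cofactor `a` (cell: `a = 4`, `ℓ` odd): from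
  `a·m + x² = D`, `ℓ^{2k} ∣ D`, `m ≠ 0`, `v_ℓ(m)` is EVEN or `≥ 2k` (`factorization_even_or_ge`), hence
  `≥ 2k + 1` when odd; Part F composes it with Part D (`law_inert_odd_of_shape`: for odd inert `ℓ` only the
  parity hypothesis remains).
NOT proved here (hypotheses `hzero`/`hodd`/`hfloor`): the Hilbert-symbol inputs of Lemmas 2–3, the
ramified-cell and `ℓ = 2` case analysis of Lemma 4, and the identification of A's code objects with these
shapes (§5af; LEAD-READ-5AF-g38).  Nothing here concerns the truth side `T_1 (+H) = 2·v_ℓ(Res)`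
([cite: LauterViray2015SingularModuli, Thm. 1.5], [cite: GrossZagier1985SingularModuli, Thm. 1.3]; tested
on data, registered test G45-TCL, ABSHODGE LOG 2026-08-23T21:32:24Z).  No `sorry`, no new axioms, no
definitions.
-/


namespace Summit.HodgeConjecture.HodgeConjecture.HodgeLocus.Census.LVTermwiseLaw

open Finset

set_option linter.dupNamespace false

/-! ### Part A — Lemma 1: inclusion–exclusion over moduli coprime to `ℓ` -/

section InclExcl

/-- A modulus coprime to `ℓ` divides `ℓ^e · n` iff it divides `n`. -/
theorem coprime_dvd_prime_pow_mul_iff {q ℓ : ℕ} (e n : ℕ) (hq : Nat.Coprime q ℓ) :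
    q ∣ ℓ ^ e * n ↔ q ∣ n :=
  ⟨fun h => (Nat.Coprime.pow_right e hq).dvd_of_dvd_mul_left h, fun h => Dvd.dvd.mul_left h _⟩

/-- If `q ∣ n` and `ℓ ∤ n` then `ℓ ∤ n / q`. -/
theorem not_dvd_div_of_not_dvd {ℓ n q : ℕ} (hqn : q ∣ n) (hn : ¬ ℓ ∣ n) : ¬ ℓ ∣ n / q :=
  fun h => hn ((Nat.div_mul_cancel hqn) ▸ Dvd.dvd.mul_right h q)

/-- LEMMA 1 (abstract form).  Let `f : ℕ → ℤ` have the `ℓ`-local factorisation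
`f(ℓ^e · n) = c(e) · f(n)` for `ℓ ∤ n`, and let `Q` be a finite set of moduli all coprime to `ℓ`, with signs
(or any integer coefficients) `ε`.  Then the inclusion–exclusion sum `F(N) := Σ_{q ∈ Q, q ∣ N} ε_q f(N/q)`
has the same local factorisation: `F(ℓ^e · n) = c(e) · F(n)` for `ℓ ∤ n`. -/
theorem inclExcl_local_factor {ℓ : ℕ} (f : ℕ → ℤ) (c : ℕ → ℤ) (ε : ℕ → ℤ) (Q : Finset ℕ)
    (hQ : ∀ q ∈ Q, Nat.Coprime q ℓ)
    (hf : ∀ e n, ¬ ℓ ∣ n → f (ℓ ^ e * n) = c e * f n)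
    {n : ℕ} (hn : ¬ ℓ ∣ n) (e : ℕ) :
    ∑ q ∈ Q.filter (· ∣ ℓ ^ e * n), ε q * f (ℓ ^ e * n / q)
      = c e * ∑ q ∈ Q.filter (· ∣ n), ε q * f (n / q) := by
  have hfilter : Q.filter (· ∣ ℓ ^ e * n) = Q.filter (· ∣ n) :=
    Finset.filter_congr (fun q hq => coprime_dvd_prime_pow_mul_iff e n (hQ q hq))
  rw [hfilter, Finset.mul_sum]
  refine Finset.sum_congr rfl (fun q hq => ?_)
  rw [Finset.mem_filter] at hq
  obtain ⟨_, hqn⟩ := hq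
  rw [Nat.mul_div_assoc _ hqn, hf e (n / q) (not_dvd_div_of_not_dvd hqn hn)]
  ring

/-- LEMMA 1 for ENGINE A's `𝔄`-shape: with `σ_χ(M) = Σ_{t ∣ M} χ(t)` for a completely multiplicative
`χ : ℕ →*₀ ℤ`, a prime `ℓ`, moduli `Q` coprime to `ℓ` and coefficients `ε`,
`𝔄(ℓ^e n) = (Σ_{i ≤ e} χ(ℓ)^i) · 𝔄(n)` for `ℓ ∤ n` (composition of `inclExcl_local_factor` with anchor 53's
`divisorSum_prime_pow_mul`). -/
theorem frakA_local_factor (χ : ℕ →*₀ ℤ) (ε : ℕ → ℤ) (Q : Finset ℕ) {ℓ : ℕ} (hℓ : ℓ.Prime)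
    (hQ : ∀ q ∈ Q, Nat.Coprime q ℓ) {n : ℕ} (hn : ¬ ℓ ∣ n) (e : ℕ) :
    ∑ q ∈ Q.filter (· ∣ ℓ ^ e * n), ε q * ∑ t ∈ (ℓ ^ e * n / q).divisors, χ t
      = (∑ i ∈ range (e + 1), χ ℓ ^ i) *
          ∑ q ∈ Q.filter (· ∣ n), ε q * ∑ t ∈ (n / q).divisors, χ t :=
  inclExcl_local_factor (fun N => ∑ t ∈ N.divisors, χ t) (fun e => ∑ i ∈ range (e + 1), χ ℓ ^ i) ε Q
    hQ (fun e _ hn => LVLocalFactor.divisorSum_prime_pow_mul χ hℓ hn e) hn e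

/-- The INERT value of the local factor of `frakA_local_factor`: `χ(ℓ) = −1` ⇒
`Σ_{i ≤ e} χ(ℓ)^i = [e even]` (so `hF` of Parts B–D holds with `c(e) = [e even]`). -/
theorem localFactor_inert (χ : ℕ →*₀ ℤ) {ℓ : ℕ} (hχ : χ ℓ = -1) (e : ℕ) :
    ∑ i ∈ range (e + 1), χ ℓ ^ i = if Even e then 1 else 0 := by
  rw [hχ, neg_one_geom_sum]
  by_cases h : Even e
  · rw [if_pos h, if_neg (by simpa [Nat.even_add_one] using h)]
  · rw [if_neg h, if_pos (by simpa [Nat.even_add_one] using h)]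

/-- The RAMIFIED value of the local factor: `χ(ℓ) = 0` ⇒ `Σ_{i ≤ e} χ(ℓ)^i = 1` (`c ≡ 1`). -/
theorem localFactor_ramified (χ : ℕ →*₀ ℤ) {ℓ : ℕ} (hχ : χ ℓ = 0) (e : ℕ) :
    ∑ i ∈ range (e + 1), χ ℓ ^ i = 1 := by
  rw [hχ, zero_geom_sum]
  simp

/-- The SPLIT value of the local factor: `χ(ℓ) = 1` ⇒ `Σ_{i ≤ e} χ(ℓ)^i = e + 1`. -/
theorem localFactor_split (χ : ℕ →*₀ ℤ) {ℓ : ℕ} (hχ : χ ℓ = 1) (e : ℕ) :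
    ∑ i ∈ range (e + 1), χ ℓ ^ i = e + 1 := by
  rw [hχ]
  simp

end InclExcl

/-! ### Part B — the shape of one term: `m = ℓ^v m'`, `ℓ ∤ m'` -/

section Shape

variable {ℓ : ℕ}

/-- For a prime `ℓ ∤ m'`: `ℓ^r ∣ ℓ^v m' ↔ r ≤ v`. -/
theorem prime_pow_dvd_mul_iff (hℓ : ℓ.Prime) {m' : ℕ} (hm' : ¬ ℓ ∣ m') (v r : ℕ) :
    ℓ ^ r ∣ ℓ ^ v * m' ↔ r ≤ v := by
  refine ⟨fun h => ?_, fun h => (pow_dvd_pow ℓ h).trans (Dvd.intro m' rfl)⟩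
  by_contra hlt
  have h1 : ℓ ^ (v + 1) ∣ ℓ ^ v * m' := (pow_dvd_pow ℓ (not_le.1 hlt)).trans h
  rw [pow_succ] at h1
  exact hm' (Nat.dvd_of_mul_dvd_mul_left (pow_pos hℓ.pos v) h1)

/-- For `r ≤ v`: `ℓ^v m' / ℓ^r = ℓ^{v − r} m'`. -/
theorem prime_pow_mul_div (hℓ : ℓ.Prime) (m' : ℕ) {v r : ℕ} (h : r ≤ v) :
    ℓ ^ v * m' / ℓ ^ r = ℓ ^ (v - r) * m' := by
  have : ℓ ^ v * m' = ℓ ^ r * (ℓ ^ (v - r) * m') := by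
    rw [← mul_assoc, ← pow_add, Nat.add_sub_cancel' h]
  rw [this, Nat.mul_div_cancel_left _ (pow_pos hℓ.pos r)]

/-- ONE TERM IN CORE FORM (§5af, consequence of Lemma 1): if `F` has the local factorisation
`F(ℓ^e n) = c(e) F(n)` (`ℓ ∤ n`) and `m = ℓ^v m'` with `ℓ ∤ m'`, then the `x`-term of `T_r`,
`[ℓ^r ∣ m] · ρ · F(m / ℓ^r)`, equals `[r ≤ v] · (ρ F(m')) · c(v − r)`. -/
theorem term_eq_core (F : ℕ → ℤ) (c : ℕ → ℤ) (hℓ : ℓ.Prime)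
    (hF : ∀ e n, ¬ ℓ ∣ n → F (ℓ ^ e * n) = c e * F n)
    (ρ : ℤ) {m' : ℕ} (hm' : ¬ ℓ ∣ m') (v r : ℕ) :
    (if ℓ ^ r ∣ ℓ ^ v * m' then ρ * F (ℓ ^ v * m' / ℓ ^ r) else 0)
      = (if r ≤ v then ρ * F m' * c (v - r) else 0) := by
  by_cases h : r ≤ v
  · rw [if_pos ((prime_pow_dvd_mul_iff hℓ hm' v r).2 h), if_pos h, prime_pow_mul_div hℓ m' h,
      hF _ _ hm']
    ring
  · rw [if_neg (fun hd => h ((prime_pow_dvd_mul_iff hℓ hm' v r).1 hd)), if_neg h]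

/-- THE WHOLE SUM IN CORE FORM: `T_r = Σ_x [r ≤ v_x] · w_x · c(v_x − r)` with core weights
`w_x := ρ_x · F(m'_x)`. -/
theorem sum_eq_core {ι : Type*} (s : Finset ι) (F : ℕ → ℤ) (c : ℕ → ℤ) (hℓ : ℓ.Prime)
    (hF : ∀ e n, ¬ ℓ ∣ n → F (ℓ ^ e * n) = c e * F n)
    (ρ : ι → ℤ) (m' : ι → ℕ) (v : ι → ℕ) (hm' : ∀ x ∈ s, ¬ ℓ ∣ m' x) (r : ℕ) :
    ∑ x ∈ s, (if ℓ ^ r ∣ ℓ ^ v x * m' x then ρ x * F (ℓ ^ v x * m' x / ℓ ^ r) else 0)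
      = ∑ x ∈ s, (if r ≤ v x then ρ x * F (m' x) * c (v x - r) else 0) :=
  Finset.sum_congr rfl (fun x hx => term_eq_core F c hℓ hF (ρ x) (hm' x hx) (v x) r)

end Shape

/-! ### Part C — the three-cell law for core sums, from per-term hypotheses -/

section Core

variable {ι : Type*} (s : Finset ι) (w : ι → ℤ) (v : ι → ℕ) (c : ℕ → ℤ)

/-- (S) SPLIT cell / no nonzero term: if every core weight vanishes then `T_r = 0` for every `r`. -/
theorem coreSum_eq_zero_of_weights_zero (hzero : ∀ x ∈ s, w x = 0) (r : ℕ) :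
    ∑ x ∈ s, (if r ≤ v x then w x * c (v x - r) else 0) = 0 :=
  Finset.sum_eq_zero (fun x hx => by simp [hzero x hx])

/-- (I, even) INERT cell: if `c(e) = [e even]` and every nonzero core weight has ODD valuation `v_x`,
then `T_r = 0` for every EVEN `r` (in particular (Z): `T_0 = 0`). -/
theorem coreSum_inert_even (hc : ∀ e, c e = if Even e then 1 else 0)
    (hodd : ∀ x ∈ s, w x ≠ 0 → Odd (v x)) {r : ℕ} (hr : Even r) :
    ∑ x ∈ s, (if r ≤ v x then w x * c (v x - r) else 0) = 0 := by
  refine Finset.sum_eq_zero (fun x hx => ?_)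
  by_cases hw : w x = 0
  · simp [hw]
  · have hvodd := hodd x hx hw
    by_cases hle : r ≤ v x
    · have hne : ¬ Even (v x - r) := by
        rw [Nat.even_sub hle]
        intro h
        exact (Nat.not_even_iff_odd.2 hvodd) (h.2 hr)
      rw [if_pos hle, hc, if_neg hne, mul_zero]
    · rw [if_neg hle]

/-- (I, odd) INERT cell: if `c(e) = [e even]`, and every nonzero core weight has `v_x` ODD and `≥ K`,
then `T_r = T_1` for every ODD `r ≤ K` (the cell's `K` is `2k + 1`, `k = v_ℓ(cond d₂)`). -/
theorem coreSum_inert_odd (hc : ∀ e, c e = if Even e then 1 else 0)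
    (hodd : ∀ x ∈ s, w x ≠ 0 → Odd (v x)) (K : ℕ) (hfloor : ∀ x ∈ s, w x ≠ 0 → K ≤ v x)
    {r : ℕ} (hr : Odd r) (hrK : r ≤ K) :
    ∑ x ∈ s, (if r ≤ v x then w x * c (v x - r) else 0)
      = ∑ x ∈ s, (if 1 ≤ v x then w x * c (v x - 1) else 0) := by
  refine Finset.sum_congr rfl (fun x hx => ?_)
  by_cases hw : w x = 0
  · simp [hw]
  · have hvodd := hodd x hx hw
    have hrv : r ≤ v x := le_trans hrK (hfloor x hx hw)
    have h1v : 1 ≤ v x := hvodd.pos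
    have he1 : Even (v x - r) := by
      rw [Nat.even_sub hrv]
      exact iff_of_false (Nat.not_even_iff_odd.2 hvodd) (Nat.not_even_iff_odd.2 hr)
    have he2 : Even (v x - 1) := by
      rw [Nat.even_sub h1v]
      exact iff_of_false (Nat.not_even_iff_odd.2 hvodd) Nat.not_even_one
    rw [if_pos hrv, if_pos h1v, hc, hc (v x - 1), if_pos he1, if_pos he2]

/-- (R) RAMIFIED cell: if `c ≡ 1` and every nonzero core weight has `v_x ≥ K`, then
`T_r = Σ_x w_x` for every `r ≤ K`; in particular `T_r = T_0 (= T_1 when K ≥ 1)` throughout `0 ≤ r ≤ K`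
(the cell's `K` is `2k` for `ℓ = 2` and `2k + 1` for odd `ℓ`). -/
theorem coreSum_ramified (hc : ∀ e, c e = 1) (K : ℕ) (hfloor : ∀ x ∈ s, w x ≠ 0 → K ≤ v x)
    {r : ℕ} (hrK : r ≤ K) :
    ∑ x ∈ s, (if r ≤ v x then w x * c (v x - r) else 0) = ∑ x ∈ s, w x := by
  refine Finset.sum_congr rfl (fun x hx => ?_)
  by_cases hw : w x = 0
  · simp [hw]
  · rw [if_pos (le_trans hrK (hfloor x hx hw)), hc, mul_one]

/-- Vanishing above the valuations (any cell): if every nonzero core weight has `v_x ≤ K'` then `T_r = 0`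
for every `r > K'` (the sub-cell statements `T_r = 0 for r ≥ 2k + 2` of §5af, where `v_x = 2k + 1`
exactly). -/
theorem coreSum_eq_zero_of_gt (K' : ℕ) (hceil : ∀ x ∈ s, w x ≠ 0 → v x ≤ K') {r : ℕ} (hr : K' < r) :
    ∑ x ∈ s, (if r ≤ v x then w x * c (v x - r) else 0) = 0 := by
  refine Finset.sum_eq_zero (fun x hx => ?_)
  by_cases hw : w x = 0
  · simp [hw]
  · have := hceil x hx hw
    rw [if_neg (by omega)]

end Core

/-! ### Part D — the law in the arithmetic shape of ENGINE A's `T_r`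
Terms indexed by a finite set `s`; the `x`-term has weight `ρ x : ℤ` and `m x = ℓ ^ v x * m' x`, `ℓ ∤ m' x`;
`F` is any function with `F(ℓ^e n) = c(e) F(n)` for `ℓ ∤ n` (Part A: the `𝔄`-shape, `c(e) = Σ_{i≤e} χ(ℓ)^i`);
`T_r = Σ_{x ∈ s} [ℓ^r ∣ m_x]·ρ_x·F(m_x / ℓ^r)`; the inputs of §5af Lemmas 2–4 are hypotheses on the core
weights `ρ_x·F(m'_x)`. -/

section Law

variable {ι : Type*} {ℓ : ℕ} (s : Finset ι) (F : ℕ → ℤ) (c : ℕ → ℤ) (ρ : ι → ℤ) (m' v : ι → ℕ)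

/-- (S)/(I′) — no nonzero core term (split cell; or inert in `ℚ(√d₁)` and split in `ℚ(√d̃)`):
`T_r = 0` for every `r ≥ 0`. -/
theorem law_split (hℓ : ℓ.Prime) (hF : ∀ e n, ¬ ℓ ∣ n → F (ℓ ^ e * n) = c e * F n)
    (hm' : ∀ x ∈ s, ¬ ℓ ∣ m' x) (hzero : ∀ x ∈ s, ρ x * F (m' x) = 0) (r : ℕ) :
    ∑ x ∈ s, (if ℓ ^ r ∣ ℓ ^ v x * m' x then ρ x * F (ℓ ^ v x * m' x / ℓ ^ r) else 0) = 0 := by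
  rw [sum_eq_core s F c hℓ hF ρ m' v hm' r]
  exact coreSum_eq_zero_of_weights_zero s (fun x => ρ x * F (m' x)) v c hzero r

/-- (I, even) and (Z) — inert cell (`c(e) = [e even]`), every nonzero core term with odd valuation:
`T_r = 0` for every even `r`, in particular `T_0 = 0`. -/
theorem law_inert_even (hℓ : ℓ.Prime) (hF : ∀ e n, ¬ ℓ ∣ n → F (ℓ ^ e * n) = c e * F n)
    (hc : ∀ e, c e = if Even e then 1 else 0) (hm' : ∀ x ∈ s, ¬ ℓ ∣ m' x)
    (hodd : ∀ x ∈ s, ρ x * F (m' x) ≠ 0 → Odd (v x)) {r : ℕ} (hr : Even r) :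
    ∑ x ∈ s, (if ℓ ^ r ∣ ℓ ^ v x * m' x then ρ x * F (ℓ ^ v x * m' x / ℓ ^ r) else 0) = 0 := by
  rw [sum_eq_core s F c hℓ hF ρ m' v hm' r]
  exact coreSum_inert_even s (fun x => ρ x * F (m' x)) v c hc hodd hr

/-- (I, odd) — inert cell, every nonzero core term with odd valuation `≥ K` (`K = 2k + 1` in the cell):
`T_r = T_1` for every odd `r ≤ K`. -/
theorem law_inert_odd (hℓ : ℓ.Prime) (hF : ∀ e n, ¬ ℓ ∣ n → F (ℓ ^ e * n) = c e * F n)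
    (hc : ∀ e, c e = if Even e then 1 else 0) (hm' : ∀ x ∈ s, ¬ ℓ ∣ m' x)
    (hodd : ∀ x ∈ s, ρ x * F (m' x) ≠ 0 → Odd (v x)) (K : ℕ)
    (hfloor : ∀ x ∈ s, ρ x * F (m' x) ≠ 0 → K ≤ v x) {r : ℕ} (hr : Odd r) (hrK : r ≤ K) :
    ∑ x ∈ s, (if ℓ ^ r ∣ ℓ ^ v x * m' x then ρ x * F (ℓ ^ v x * m' x / ℓ ^ r) else 0)
      = ∑ x ∈ s, (if ℓ ^ 1 ∣ ℓ ^ v x * m' x then ρ x * F (ℓ ^ v x * m' x / ℓ ^ 1) else 0) := by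
  rw [sum_eq_core s F c hℓ hF ρ m' v hm' r, sum_eq_core s F c hℓ hF ρ m' v hm' 1]
  exact coreSum_inert_odd s (fun x => ρ x * F (m' x)) v c hc hodd K hfloor hr hrK

/-- (R) — ramified cell (`c ≡ 1`), every nonzero core term with valuation `≥ K` (`K = 2k` for `ℓ = 2`,
`2k + 1` for odd `ℓ`): `T_r = Σ_x ρ_x F(m'_x)` for every `r ≤ K`; hence `T_r = T_0 = T_1` on `0 ≤ r ≤ K`. -/
theorem law_ramified (hℓ : ℓ.Prime) (hF : ∀ e n, ¬ ℓ ∣ n → F (ℓ ^ e * n) = c e * F n)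
    (hc : ∀ e, c e = 1) (hm' : ∀ x ∈ s, ¬ ℓ ∣ m' x) (K : ℕ)
    (hfloor : ∀ x ∈ s, ρ x * F (m' x) ≠ 0 → K ≤ v x) {r : ℕ} (hrK : r ≤ K) :
    ∑ x ∈ s, (if ℓ ^ r ∣ ℓ ^ v x * m' x then ρ x * F (ℓ ^ v x * m' x / ℓ ^ r) else 0)
      = ∑ x ∈ s, ρ x * F (m' x) := by
  rw [sum_eq_core s F c hℓ hF ρ m' v hm' r]
  exact coreSum_ramified s (fun x => ρ x * F (m' x)) v c hc K hfloor hrK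

/-- Vanishing above the valuations, arithmetic shape: every nonzero core term with `v_x ≤ K'` ⇒
`T_r = 0` for `r > K'`. -/
theorem law_eq_zero_of_gt (hℓ : ℓ.Prime) (hF : ∀ e n, ¬ ℓ ∣ n → F (ℓ ^ e * n) = c e * F n)
    (hm' : ∀ x ∈ s, ¬ ℓ ∣ m' x) (K' : ℕ) (hceil : ∀ x ∈ s, ρ x * F (m' x) ≠ 0 → v x ≤ K')
    {r : ℕ} (hr : K' < r) :
    ∑ x ∈ s, (if ℓ ^ r ∣ ℓ ^ v x * m' x then ρ x * F (ℓ ^ v x * m' x / ℓ ^ r) else 0) = 0 := by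
  rw [sum_eq_core s F c hℓ hF ρ m' v hm' r]
  exact coreSum_eq_zero_of_gt s (fun x => ρ x * F (m' x)) v c K' hceil hr

end Law

/-! ### Part E — Lemma 4 (I) for a prime not dividing the cofactor (odd `ℓ` in the cell) -/

section Valuation

/-- `v_ℓ(ℓ^v · m') = v` for a prime `ℓ ∤ m'`. -/
theorem factorization_prime_pow_mul {ℓ : ℕ} (hℓ : ℓ.Prime) {m' : ℕ} (hm' : ¬ ℓ ∣ m') (v : ℕ) :
    (ℓ ^ v * m').factorization ℓ = v := by
  have hm'0 : m' ≠ 0 := fun h0 => hm' (h0 ▸ dvd_zero ℓ)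
  rw [Nat.factorization_mul (pow_ne_zero v hℓ.ne_zero) hm'0, Finsupp.add_apply,
    hℓ.factorization_pow, Finsupp.single_eq_same, Nat.factorization_eq_zero_of_not_dvd hm', add_zero]

/-- LEMMA 4 (I), prime-to-cofactor form: if the prime `ℓ` does not divide `a`, `ℓ^{2k} ∣ D`, `m ≠ 0` and
`a·m + x² = D`, then `v_ℓ(m)` is EVEN or `v_ℓ(m) ≥ 2k`.  (In the cell: `a = 4`, `ℓ` odd, `D = d₁d₂ > 0`,
`4m = D − x²`, `k = v_ℓ(cond d₂)`, so `ℓ^{2k} ∣ d₂ ∣ D`.)  Proof: if `ℓ^k ∣ x` then `ℓ^{2k} ∣ D − x² = a m`;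
otherwise `j := v_ℓ(x) < k` and `v_ℓ(a m) = v_ℓ(D − x²) = 2j` exactly. -/
theorem factorization_even_or_ge {ℓ a k D x m : ℕ} (hℓ : ℓ.Prime) (ha : ¬ ℓ ∣ a)
    (hD : ℓ ^ (2 * k) ∣ D) (hm : m ≠ 0) (hxD : a * m + x ^ 2 = D) :
    Even (m.factorization ℓ) ∨ 2 * k ≤ m.factorization ℓ := by
  have hcop : ∀ n, Nat.Coprime (ℓ ^ n) a := fun n =>
    Nat.Coprime.pow_left _ ((Nat.Prime.coprime_iff_not_dvd hℓ).2 ha)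
  have ham_eq : a * m = D - x ^ 2 := by omega
  by_cases hkx : ℓ ^ k ∣ x
  · right
    have hx2 : ℓ ^ (2 * k) ∣ x ^ 2 := by
      rw [mul_comm, pow_mul]
      exact pow_dvd_pow_of_dvd hkx 2
    have ham : ℓ ^ (2 * k) ∣ a * m := by
      rw [ham_eq]
      exact Nat.dvd_sub hD hx2
    exact (hℓ.pow_dvd_iff_le_factorization hm).1 ((hcop _).dvd_of_dvd_mul_left ham)
  · left
    have hx0 : x ≠ 0 := fun h0 => hkx (h0 ▸ dvd_zero _)
    have hx2ne : x ^ 2 ≠ 0 := pow_ne_zero 2 hx0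
    have hjk : x.factorization ℓ < k := by
      by_contra hle
      rw [not_lt] at hle
      exact hkx ((hℓ.pow_dvd_iff_le_factorization hx0).2 hle)
    have hx2j : (x ^ 2).factorization ℓ = 2 * x.factorization ℓ := by
      rw [Nat.factorization_pow, Finsupp.smul_apply, smul_eq_mul]
    have h2jD : ℓ ^ (2 * x.factorization ℓ) ∣ D := (pow_dvd_pow ℓ (by omega)).trans hD
    have h2jx : ℓ ^ (2 * x.factorization ℓ) ∣ x ^ 2 :=
      (hℓ.pow_dvd_iff_le_factorization hx2ne).2 (by rw [hx2j])
    have hlow : 2 * x.factorization ℓ ≤ m.factorization ℓ := by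
      apply (hℓ.pow_dvd_iff_le_factorization hm).1
      apply (hcop _).dvd_of_dvd_mul_left
      rw [ham_eq]
      exact Nat.dvd_sub h2jD h2jx
    have hhigh : ¬ 2 * x.factorization ℓ + 1 ≤ m.factorization ℓ := by
      intro hle
      have h1 : ℓ ^ (2 * x.factorization ℓ + 1) ∣ m := (hℓ.pow_dvd_iff_le_factorization hm).2 hle
      have h2 : ℓ ^ (2 * x.factorization ℓ + 1) ∣ D := (pow_dvd_pow ℓ (by omega)).trans hD
      have h3 : ℓ ^ (2 * x.factorization ℓ + 1) ∣ x ^ 2 := by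
        have hx2eq : x ^ 2 = D - a * m := by omega
        rw [hx2eq]
        exact Nat.dvd_sub h2 (h1.mul_left a)
      have h4 := (hℓ.pow_dvd_iff_le_factorization hx2ne).1 h3
      rw [hx2j] at h4
      omega
    have heq : m.factorization ℓ = 2 * x.factorization ℓ := by omega
    exact ⟨x.factorization ℓ, by rw [heq]; ring⟩

/-- LEMMA 4 (I) with LEMMA 3's parity: if moreover `v_ℓ(m)` is ODD then `v_ℓ(m) ≥ 2k + 1`. -/
theorem factorization_ge_of_odd {ℓ a k D x m : ℕ} (hℓ : ℓ.Prime) (ha : ¬ ℓ ∣ a)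
    (hD : ℓ ^ (2 * k) ∣ D) (hm : m ≠ 0) (hxD : a * m + x ^ 2 = D)
    (hodd : Odd (m.factorization ℓ)) : 2 * k + 1 ≤ m.factorization ℓ := by
  rcases factorization_even_or_ge hℓ ha hD hm hxD with h | h
  · exact absurd h (Nat.not_even_iff_odd.2 hodd)
  · obtain ⟨t, ht⟩ := hodd
    omega

end Valuation

/-! ### Part F — (I, odd) with the floor discharged by Part E; only the parity hypothesis remains -/

section LawShape

variable {ι : Type*} {ℓ : ℕ} (s : Finset ι) (F : ℕ → ℤ) (c : ℕ → ℤ) (ρ : ι → ℤ) (m' v : ι → ℕ)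

/-- (I, odd), arithmetic shape, floor discharged: a prime `ℓ ∤ a` (the cell: `a = 4`, `ℓ` odd),
`ℓ^{2k} ∣ D`, every term of the shape `a·m_x + X_x² = D` with `m_x = ℓ^{v_x} m'_x`, `ℓ ∤ m'_x`; if every
nonzero core term has odd `v_x`, then `T_r = T_1` for every odd `r ≤ 2k + 1`. -/
theorem law_inert_odd_of_shape (hℓ : ℓ.Prime) (hF : ∀ e n, ¬ ℓ ∣ n → F (ℓ ^ e * n) = c e * F n)
    (hc : ∀ e, c e = if Even e then 1 else 0) (hm' : ∀ x ∈ s, ¬ ℓ ∣ m' x)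
    {a k D : ℕ} (ha : ¬ ℓ ∣ a) (hD : ℓ ^ (2 * k) ∣ D) (X : ι → ℕ)
    (hshape : ∀ x ∈ s, a * (ℓ ^ v x * m' x) + X x ^ 2 = D)
    (hodd : ∀ x ∈ s, ρ x * F (m' x) ≠ 0 → Odd (v x)) {r : ℕ} (hr : Odd r) (hrK : r ≤ 2 * k + 1) :
    ∑ x ∈ s, (if ℓ ^ r ∣ ℓ ^ v x * m' x then ρ x * F (ℓ ^ v x * m' x / ℓ ^ r) else 0)
      = ∑ x ∈ s, (if ℓ ^ 1 ∣ ℓ ^ v x * m' x then ρ x * F (ℓ ^ v x * m' x / ℓ ^ 1) else 0) := by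
  refine law_inert_odd s F c ρ m' v hℓ hF hc hm' hodd (2 * k + 1) ?_ hr hrK
  intro x hx hw
  have hm'0 : m' x ≠ 0 := fun h0 => hm' x hx (h0 ▸ dvd_zero ℓ)
  have hm0 : ℓ ^ v x * m' x ≠ 0 := mul_ne_zero (pow_ne_zero _ hℓ.ne_zero) hm'0
  have hv : (ℓ ^ v x * m' x).factorization ℓ = v x := factorization_prime_pow_mul hℓ (hm' x hx) (v x)
  have h := factorization_ge_of_odd hℓ ha hD hm0 (hshape x hx) (by rw [hv]; exact hodd x hx hw)
  rwa [hv] at h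

end LawShape

end Summit.HodgeConjecture.HodgeConjecture.HodgeLocus.Census.LVTermwiseLaw
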